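import Mathlib.Analysis.Complex.RemovableSingularity
import Mathlib.Analysis.Complex.AbsMax
import HarnessLib

/-!
# Dividing out finitely many zeros on a disc and the resulting maximum-modulus bound

The extrapolation step of Schneider's method on a DISC (rather than for entire functions, which is
`Literature.NumberTheory.Transcendental.Baker1975.Analytic`): if `f` is holomorphic on an open
set `U`, vanishes at the points of a finite set `s ⊆ U`, then `f = (∏_{c ∈ s} (z - c)) · g` with
`g` holomorphic on `U` (`exists_eq_prod_mul_of_eq_zero`, removable singularities via
`Complex.differentiableOn_dslope`); and if moreover `closedBall 0 R ⊆ U`, `|f| ≤ θ` and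
`|∏ (z - c)| ≥ m > 0` on the circle `|z| = R`, then `|f(w)| ≤ (θ / m) · |∏ (w - c)|` for
`|w| ≤ R` (`norm_le_of_eq_zero`, maximum modulus principle applied to `g`). The crude corollary
`norm_le_of_eq_zero_of_norm_le_half` packages the case where all zeros lie in `|z| ≤ R/2`:
`|f(w)| ≤ θ · (2/R)^{#s} · ∏ |w - c|`.

Simple zeros only (that is all Schneider's method in Pólya form needs); the version with
multiplicities for entire functions is `Baker1975.Analytic.norm_le_of_analyticOrderAt`.

## References

* [folklore] standard; e.g. M. Waldschmidt, *Nombres transcendants*, LNM 402 (1974), Ch. 1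
  (Schwarz lemma), or A. Baker, *Transcendental Number Theory* (1975), Ch. 2 Lemma 4.
-/

noncomputable section

open Metric Finset Filter
open _root_.Complex _root_.Topology

namespace Literature.Analysis.Complex

/-- **Division by one zero on an open set.** If `f` is holomorphic on an open set `U`, `c ∈ U` and
`f c = 0`, then `f z = (z - c) · g z` for all `z`, with `g = dslope f c` holomorphic on `U`.
[folklore] -/
theorem exists_eq_sub_mul_of_eq_zero {f : ℂ → ℂ} {U : Set ℂ} (hU : IsOpen U)
    (hf : DifferentiableOn ℂ f U) {c : ℂ} (hc : c ∈ U) (hfc : f c = 0) :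
    ∃ g : ℂ → ℂ, DifferentiableOn ℂ g U ∧ ∀ z, f z = (z - c) * g z := by
  refine ⟨dslope f c, (Complex.differentiableOn_dslope (hU.mem_nhds hc)).mpr hf, fun z => ?_⟩
  have h := sub_smul_dslope f c z
  rw [smul_eq_mul, hfc, sub_zero] at h
  exact h.symm

/-- **Division by finitely many simple zeros on an open set.** If `f` is holomorphic on an open
set `U` and vanishes at every point of a finite set `s ⊆ U`, then
`f z = (∏_{c ∈ s} (z - c)) · g z` for all `z`, with `g` holomorphic on `U`. [folklore] -/
theorem exists_eq_prod_mul_of_eq_zero {f : ℂ → ℂ} {U : Set ℂ} (hU : IsOpen U)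
    (hf : DifferentiableOn ℂ f U) (s : Finset ℂ) (hsU : ∀ c ∈ s, c ∈ U)
    (hfs : ∀ c ∈ s, f c = 0) :
    ∃ g : ℂ → ℂ, DifferentiableOn ℂ g U ∧ ∀ z, f z = (∏ c ∈ s, (z - c)) * g z := by
  classical
  induction s using Finset.induction_on generalizing f with
  | empty => exact ⟨f, hf, fun z => by simp⟩
  | insert c s hc ih =>
    obtain ⟨g₁, hg₁, hfg₁⟩ := exists_eq_sub_mul_of_eq_zero hU hf (hsU c (mem_insert_self c s))
      (hfs c (mem_insert_self c s))
    have h' : ∀ c' ∈ s, g₁ c' = 0 := by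
      intro c' hc'
      have hne : c' - c ≠ 0 := sub_ne_zero.mpr fun e => hc (e ▸ hc')
      have h0 := hfs c' (mem_insert_of_mem hc')
      rw [hfg₁ c'] at h0
      exact (mul_eq_zero.mp h0).resolve_left hne
    obtain ⟨g, hg, hg₁g⟩ := ih hg₁ (fun c' hc' => hsU c' (mem_insert_of_mem hc')) h'
    refine ⟨g, hg, fun z => ?_⟩
    rw [hfg₁ z, hg₁g z, prod_insert hc]
    ring

/-- **Maximum modulus with prescribed simple zeros on a disc.** Let `f` be holomorphic on an open
set `U ⊇ closedBall 0 R`, `R > 0`, vanishing on the finite set `s ⊆ U`; if `|f| ≤ θ` and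
`|∏_{c ∈ s} (z - c)| ≥ m > 0` on the circle `|z| = R`, then `|f(w)| ≤ (θ/m) · |∏_{c∈s} (w - c)|`
for every `|w| ≤ R`. [folklore] -/
theorem norm_le_of_eq_zero {f : ℂ → ℂ} {U : Set ℂ} (hU : IsOpen U)
    (hf : DifferentiableOn ℂ f U) {R : ℝ} (hR : 0 < R) (hRU : closedBall (0 : ℂ) R ⊆ U)
    (s : Finset ℂ) (hsU : ∀ c ∈ s, c ∈ U) (hfs : ∀ c ∈ s, f c = 0) {θ m : ℝ}
    (hθ : ∀ z ∈ sphere (0 : ℂ) R, ‖f z‖ ≤ θ) (hm : 0 < m)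
    (hmF : ∀ z ∈ sphere (0 : ℂ) R, m ≤ ‖∏ c ∈ s, (z - c)‖) {w : ℂ} (hw : ‖w‖ ≤ R) :
    ‖f w‖ ≤ θ / m * ‖∏ c ∈ s, (w - c)‖ := by
  obtain ⟨g, hg, hfg⟩ := exists_eq_prod_mul_of_eq_zero hU hf s hsU hfs
  have hgb : ∀ z ∈ frontier (ball (0 : ℂ) R), ‖g z‖ ≤ θ / m := by
    rw [frontier_ball (0 : ℂ) hR.ne']
    intro z hz
    have hF := hmF z hz
    have hfz : ‖f z‖ = ‖∏ c ∈ s, (z - c)‖ * ‖g z‖ := by rw [hfg z, norm_mul]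
    rw [le_div_iff₀ hm]
    calc ‖g z‖ * m ≤ ‖g z‖ * ‖∏ c ∈ s, (z - c)‖ := by gcongr
      _ = ‖f z‖ := by rw [hfz, mul_comm]
      _ ≤ θ := hθ z hz
  have hgd : DiffContOnCl ℂ g (ball (0 : ℂ) R) := by
    refine DifferentiableOn.diffContOnCl ?_
    rw [closure_ball (0 : ℂ) hR.ne']
    exact hg.mono hRU
  have hgw : ‖g w‖ ≤ θ / m :=
    Complex.norm_le_of_forall_mem_frontier_norm_le isBounded_ball hgd hgb
      (by rw [closure_ball (0 : ℂ) hR.ne']; simpa using hw)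
  rw [hfg w, norm_mul]
  calc ‖∏ c ∈ s, (w - c)‖ * ‖g w‖ ≤ ‖∏ c ∈ s, (w - c)‖ * (θ / m) := by gcongr
    _ = θ / m * ‖∏ c ∈ s, (w - c)‖ := mul_comm _ _

/-- **Crude Schwarz lemma with simple zeros in the half disc.** Let `f` be holomorphic on an open
set `U ⊇ closedBall 0 R`, `R > 0`, vanishing on the finite set `s` with `|c| ≤ R/2` for `c ∈ s`,
and `|f| ≤ θ` on `|z| = R`. Then for `|w| ≤ R`,
`|f(w)| ≤ θ · (2/R)^{#s} · ∏_{c ∈ s} |w - c|`. [folklore] -/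
theorem norm_le_of_eq_zero_of_norm_le_half {f : ℂ → ℂ} {U : Set ℂ} (hU : IsOpen U)
    (hf : DifferentiableOn ℂ f U) {R : ℝ} (hR : 0 < R) (hRU : closedBall (0 : ℂ) R ⊆ U)
    (s : Finset ℂ) (hs : ∀ c ∈ s, ‖c‖ ≤ R / 2) (hfs : ∀ c ∈ s, f c = 0) {θ : ℝ}
    (hθ : ∀ z ∈ sphere (0 : ℂ) R, ‖f z‖ ≤ θ) {w : ℂ} (hw : ‖w‖ ≤ R) :
    ‖f w‖ ≤ θ * (2 / R) ^ s.card * ∏ c ∈ s, ‖w - c‖ := by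
  have hsU : ∀ c ∈ s, c ∈ U := fun c hc =>
    hRU (mem_closedBall_zero_iff.mpr ((hs c hc).trans (by linarith)))
  have hm : (0 : ℝ) < (R / 2) ^ s.card := by positivity
  have hmF : ∀ z ∈ sphere (0 : ℂ) R, (R / 2) ^ s.card ≤ ‖∏ c ∈ s, (z - c)‖ := by
    intro z hz
    rw [norm_prod, ← prod_const]
    refine prod_le_prod (fun _ _ => by positivity) fun c hc => ?_
    have hz' : ‖z‖ = R := mem_sphere_zero_iff_norm.mp hz
    calc R / 2 = R - R / 2 := by ring
      _ ≤ ‖z‖ - ‖c‖ := by rw [hz']; linarith [hs c hc]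
      _ ≤ ‖z - c‖ := norm_sub_norm_le z c
  have h := norm_le_of_eq_zero hU hf hR hRU s hsU hfs hθ hm hmF hw
  rw [norm_prod] at h
  calc ‖f w‖ ≤ θ / (R / 2) ^ s.card * ∏ c ∈ s, ‖w - c‖ := h
    _ = θ * (2 / R) ^ s.card * ∏ c ∈ s, ‖w - c‖ := by
        rw [div_pow, div_pow, div_eq_mul_inv, inv_div, div_eq_mul_inv (2 ^ s.card : ℝ),
          ← div_eq_mul_inv _ (R ^ s.card)]

end Literature.Analysis.Complex

end
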